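import Summits.CriticalPhenomena.SAWScalingLimit.Theorems.SAWLeftRightFKGFKGToTraversalBoundSlitNecklaceFarTip
import HarnessLib

/-!
# Vocabulary of line `slit-necklace`, part 4 (reshape r4.1): the far-tip necklace witness in RANK-UNIFORM form

Crux `SAWLeftRightFKG.FKGToTraversalBound` (stmt-CriticalPhenomena-1878), line `slit-necklace`, lead
prover-line-stmt-CriticalPhenomena-1878-c5-0; chart `Cruxes/FKGToTraversalBound/Lines/slit-necklace-chart-r4.md`.

Why.  The r4 assembly (cascade of net shells, chart r4 §3 A3–A4) descends from a far piece overloaded at one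
cascade shell to a LOWER-RANK far piece overloaded at a shell of the next level; the descent needs ONE rank on the
far pieces of the configuration serving ALL shells of the (finite) cascade family, whereas `NecklaceWitnessFar`
(part 3) quantifies `∃ rk` after the shell — per-shell ranks admit level-alternating ranks with no stopping point
(finding of the assembly worker, wave 1 of lead c5).  The natural proof of the witness gives a rank that is a
property of the planar structure of the configuration alone (nesting forest of loops per spine component, dual tree
of crosscuts), so the uniform form below is what the planar lemma delivers anyway: one boundary-budget FUNCTION
`nB (y, σ₁, σ₂)` per domain, and for every finite family of genuine shells, eventually in the mesh, for every
presented chord one rank whose lower sets control the witness at every shell of the family whose band is far from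
the marked centres.  `NecklaceWitnessFarU → NecklaceWitnessFar` (`necklaceWitnessFar_of_uniform`, registered glue,
family of one shell).

Definitions and one closed glue theorem; no literature fact; nothing restates the crux.
-/

noncomputable section

open MeasureTheory Filter Topology Set Metric
open scoped NNReal ENNReal
open Literature.Probability.LatticeModels
open Literature.Probability.RandomPlanarGeometry
open Literature.Probability.RandomPlanarGeometry.SAW
open Summit.CriticalPhenomena.SAWScalingLimit.Theorems.FKGToTraversalBound.Negative (dom)

namespace Summit.CriticalPhenomena.SAWScalingLimit.Theorems.FKGToTraversalBound.SlitNecklace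

/-- **NECKLACE WITNESS, FAR-TIP, RANK-UNIFORM FORM** (reshape r4.1 of `NecklaceWitnessFar`; deterministic planar
topology — the line's own hard lemma, in the form the cascade consumes).  For every Dobrushin domain there is a
boundary-budget function `nB` of the shell such that for every FINITE family of genuine shells
`D(y t; σ₁ t, σ₂ t)`, for all small meshes, every tame presentation `(C, S)` of `D_δ` with attached spine
`Ka ∪ Kb ∪ S` (blobs within `ιa, ιb` of the marked centres, `ιa + 3δ ≤ η`, `ιb + 3δ ≤ η`, `2η + δ < |ca - cb|`) and
every self-avoiding chord `γ` from `Ka` to `Kb` carry ONE rank on the far pieces, of height `≤ #far`, such that at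
every shell of the family that is `4δ`-genuine and whose closed band is `2η`-far from both centres, every far-tip
piece whose lower-rank far pieces have at most `W` windows across the `2δ`-thinner shell admits a far-tip witness
with fewer than `8 (#far + #S + 2)² (W + nB + 2)` strictly separated windows.  Route and cost as in
`NecklaceWitnessFar` (outline arc of the face of the arrangement; `abab`-free hugging runs); the rank is the height
in "lies inside the loop of" ∪ "bounds the child face of the crosscut", independent of the shell.
(HYPOTHESIS NAME of the line — a definition used as a stub conclusion/hypothesis, not a literature fact; OPEN as a
formalisation task, believed true.) -/
def NecklaceWitnessFarU : Prop :=
  ∀ (D : DobrushinDomain), ∃ nB : ℂ → ℝ → ℝ → ℕ, ∀ (ι : Type) [Fintype ι] (y : ι → ℂ) (σ₁ σ₂ : ι → ℝ), (∀ t, 0 < σ₁ t ∧ σ₁ t < σ₂ t) → ∀ᶠ δ in 𝓝[>] (0 : ℝ), ∀ (c : Site 2) (C : (zdGraph 2).Walk c c) (S Ka Kb : Finset (Site 2)) (a₀ b₀ : Site 2) (ca cb : ℂ) (ιa ιb η : ℝ) (γ : (discreteDomainGraph D.carrier δ).Walk a₀ b₀), (∀ x' y' : Site 2, (discreteDomainGraph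 (dom C δ) δ).Adj x' y' ↔ ((discreteDomainGraph D.carrier δ).Adj x' y' ∧ x' ∉ S ∧ y' ∉ S)) → (∀ k ∈ Ka ∪ Kb ∪ S, ∃ (q : Site 2) (w : (zdGraph 2).Walk k q), q ∈ C.support ∧ ∀ z ∈ w.support, z ∈ Ka ∪ Kb ∪ S ∨ z ∈ C.support) → γ.IsPath → a₀ ∈ Ka → b₀ ∈ Kb → (∀ k ∈ Ka, dist (meshPoint δ k) ca ≤ ιa) → (∀ k ∈ Kb, dist (meshPoint δ k) cb ≤ ιb) → ιa + 3 * δ ≤ η → ιb + 3 * δ ≤ η → 2 * η + δ < dist ca cb → ∃ rk : ℕ → ℕ, (∀ i, rk i ≤ {i' : ℕ | ∃ j', IsFarPiece (meshPoint δ) γ (↑(Ka ∪ Kb ∪ S)) (↑S) i' j' ca cb η}.ncard) ∧ ∀ t : ι, 4 * δ < σ₂ t - σ₁ t → (∀ z : ℂ, σ₁ t ≤ dist z (y t) → dist z (y t) ≤ σ₂ t → 2 * η ≤ dist z ca ∧ 2 * η ≤ dist z cb) → ∀ (i j τ τ' W : ℕ), IsFarTipPiece (meshPoint δ) γ (↑(Ka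 ∪ Kb ∪ S)) i j τ τ' ca cb η → (∀ i' j', IsFarPiece (meshPoint δ) γ (↑(Ka ∪ Kb ∪ S)) (↑S) i' j' ca cb η → rk i' < rk i → ¬ HasSepWindows (meshPoint δ) γ (W + 1) (i' + 1) (j' - 1) (y t) (σ₁ t + 2 * δ) (σ₂ t - 2 * δ)) → HasFarTipWitness D.carrier δ (↑(Ka ∪ Kb ∪ S)) γ τ τ' (8 * ({i' : ℕ | ∃ j', IsFarPiece (meshPoint δ) γ (↑(Ka ∪ Kb ∪ S)) (↑S) i' j' ca cb η}.ncard + S.card + 2) ^ 2 * (W + nB (y t) (σ₁ t) (σ₂ t) + 2)) (y t) (σ₁ t) (σ₂ t)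

/-- **Registered glue (r4.1): the rank-uniform witness gives the per-shell witness** (family of one shell).
[folklore] -/
theorem necklaceWitnessFar_of_uniform : NecklaceWitnessFarU → NecklaceWitnessFar := by
  intro hU D y σ₁ σ₂ hσ₁ hσ₁₂
  obtain ⟨nB, hnB⟩ := hU D
  refine ⟨nB y σ₁ σ₂, ?_⟩
  filter_upwards [hnB Unit (fun _ => y) (fun _ => σ₁) (fun _ => σ₂) (fun _ => ⟨hσ₁, hσ₁₂⟩)] with δ hδ
  intro c C S Ka Kb a₀ b₀ ca cb ιa ιb η γ hid hatt hγ ha₀ hb₀ hKa hKb hιa hιb hab h4 hband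
  obtain ⟨rk, hrk, hwit⟩ := hδ c C S Ka Kb a₀ b₀ ca cb ιa ιb η γ hid hatt hγ ha₀ hb₀ hKa hKb hιa hιb hab
  exact ⟨rk, hrk, fun i j τ τ' W hft hlow => hwit () h4 hband i j τ τ' W hft hlow⟩

end Summit.CriticalPhenomena.SAWScalingLimit.Theorems.FKGToTraversalBound.SlitNecklace

end
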